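import Mathlib
import Literature.NumberTheory.Sieve.CoprimeSquarefreeSums
import HarnessLib

/-!
# Radziwiłł 2012, §7 (Soundararajan's quadratic form), part A: the algebraic identities

First of the files discharging the named fact
`Literature.Barriers.RiemannHypothesis.Radziwill2012_propB_quadForm`
(`Literature/Barriers/RiemannHypothesis/MollifierLimitationsPropB.lean`): Soundararajan's bound
`𝒬_T(a) = ∑_{d,e ≤ N} a(d)ā(e)/[d,e]·(log(cT) − log([d,e]/(d,e))) ≥ 1 + 1/θ + o(1)` for `N = T^θ`,
`θ < 1`, `a(1) = 1` (M. Radziwiłł, *Limitations to mollifying ζ(s)*, arXiv:1207.6583, §7,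
Lemmas 9–14). This file proves the exact identities of §7, for an arbitrary `a : ℕ → ℂ` and
`N ≥ 1`, in the notation of the source (`G = ∑_{n≤N} μ²(n)/φ(n)`, `y(ℓ) = ∑_{d ≤ N/ℓ} a(dℓ)/d`,
`z(ℓ) = μ(ℓ)ℓ/(Gφ(ℓ))`, `w = y − z`, `D = ∑ φ(ℓ)/ℓ²|w(ℓ)|²`):

* `diag_identity` — the diagonalisation behind (7.2): for any weights `H`,
  `∑_{d,e ≤ N} u(d)v̄(e)/(de)·∑_{ℓ∣(d,e)} H(ℓ) = ∑_ℓ H(ℓ)/ℓ² Y_u(ℓ)Ȳ_v(ℓ)`;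
* `sum_moebius_mul_yv_div` — Möbius inversion `∑ μ(ℓ)y(ℓ)/ℓ = a(1)`;
* `F1_eq`, `Dv_eq` — **Lemma 9**: `F₁ := ∑ a(d)ā(e)/[d,e] = ∑ φ(ℓ)/ℓ²|y(ℓ)|² = 1/G + D`
  (for `a(1) = 1`);
* `re_F2_le` — the second form `F₂ := ∑ a(d)ā(e)/[d,e] log([d,e]/(d,e))` satisfies
  `Re F₂ ≤ 2 Re B(y,y)` with `B(u,v) = ∑_ℓ ∑_{m ≤ N/ℓ} φ(ℓ)Λ(m)/(ℓ²m) u(mℓ)v̄(ℓ)`. This is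
  **Lemma 11** with its error term identified exactly and signed:
  `F₂ = 2Re B(y,y) − 2∑_ℓ (φ⋆Λ)(ℓ)/ℓ²|y(ℓ)|²` (via `log([d,e]/(d,e)) = log d + log e − 2log(d,e)`,
  `(d,e)log(d,e) = ∑_{ℓ∣(d,e)} h(ℓ)` with `h = φ·log + φ⋆Λ`, and `log d = ∑_{m∣d} Λ(m)`), so that
  the prime-power bookkeeping of the printed proof is not needed for the lower bound;
* `Bf_yv_yv`, `Bf_zC_zC`, `Bf_wv_zC`, `Bf_zC_wv`, `re_Bf_cross`, `abs_re_Bf_cross_le`,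
  `two_mul_norm_Bf_wv_wv_le` — the decomposition `B(y,y) = S₃ + S₂ + S₁` of (7.9) and the
  algebraic cores of **Lemmas 12–14**: `B(z,z) = −(1/G²)∑_{k≤N} μ²(k) log k/φ(k)` (from
  `Λ⋆μ = −μ·log`), `B(w,z) = −(1/G)∑ w(k)μ(k)log k/k`, `B(z,w) = (1/G)∑ w̄(ℓ)ρ(ℓ)/ℓ`, the
  constraint `∑ μ(ℓ)Re w(ℓ)/ℓ = 0` and the resulting cross-term bound, and
  `2|B(w,w)| ≤ ∑ φ(ℓ)/ℓ²|w(ℓ)|² ∑_{m≤N/ℓ}Λ(m)/m + ∑ h(k)/k²|w(k)|²` with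
  `∑_{ℓm=k} φ(ℓ)Λ(m)m = h(k)`.

The arithmetic-function identities (`D(f⋆g) = Df⋆g + f⋆Dg` for `Df = f·log`, `Λ⋆μ = −Dμ`,
`(Λ·id)⋆φ = h`, `h⋆ζ = D(id)`) are proved over Mathlib's `ArithmeticFunction ℝ`. The analytic
estimates (Mertens, `G = log N + O(1)`) and the assembly are in the sibling part B / part C files.

## References

* [Radziwill2012] M. Radziwiłł, *Limitations to mollifying ζ(s)*, arXiv:1207.6583 (2012), §7,
  pp. 12–14: eqs. (7.1), (7.2), Lemma 9, Lemmas 11–14 and displays (7.8)–(7.10).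
-/

noncomputable section

open Finset ArithmeticFunction Complex
open scoped ArithmeticFunction.Moebius ArithmeticFunction.zeta ComplexConjugate

namespace Literature.Barriers.RiemannHypothesis

namespace PropB

open Literature.NumberTheory.Sieve.SquarefreeSums (sum_Icc_sum_divisorsAntidiagonal)

variable (N : ℕ)

/-! ### The objects of §7 -/

/-- `G = ∑_{n ≤ N} μ(n)²/φ(n)`. [cite: Radziwill2012, §7 (definition of G)] -/
def Gs : ℝ := ∑ n ∈ Icc 1 N, ((μ n : ℝ)) ^ 2 / (n.totient : ℝ)

/-- `y(ℓ) = ∑_{d ≤ N/ℓ} a(dℓ)/d`. [cite: Radziwill2012, §7 (definition of y)] -/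
def yv (a : ℕ → ℂ) (ℓ : ℕ) : ℂ := ∑ d ∈ Icc 1 (N / ℓ), a (d * ℓ) / (d : ℂ)

/-- `z(ℓ) = μ(ℓ) ℓ/(G φ(ℓ))`. [cite: Radziwill2012, §7 (definition of z)] -/
def zv (ℓ : ℕ) : ℝ := (μ ℓ : ℝ) * ℓ / (Gs N * ℓ.totient)

/-- `w = y - z`. [cite: Radziwill2012, §7] -/
def wv (a : ℕ → ℂ) (ℓ : ℕ) : ℂ := yv N a ℓ - (zv N ℓ : ℂ)

/-- `D = ∑_{ℓ ≤ N} φ(ℓ)/ℓ² |y(ℓ) - z(ℓ)|²`. [cite: Radziwill2012, Lemma 9] -/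
def Dv (a : ℕ → ℂ) : ℝ := ∑ ℓ ∈ Icc 1 N, (ℓ.totient : ℝ) / (ℓ : ℝ) ^ 2 * ‖wv N a ℓ‖ ^ 2

/-- The bilinear form `B(u,v) = ∑_{ℓ ≤ N} ∑_{m ≤ N/ℓ} φ(ℓ)Λ(m)/(ℓ²m) · u(mℓ) v̄(ℓ)`.
[cite: Radziwill2012, Lemma 11] -/
def Bf (u v : ℕ → ℂ) : ℂ :=
  ∑ ℓ ∈ Icc 1 N, ∑ m ∈ Icc 1 (N / ℓ),
    (((ℓ.totient : ℝ) * Λ m / ((ℓ : ℝ) ^ 2 * m) : ℝ) : ℂ) * (u (m * ℓ) * conj (v ℓ))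

/-- `F₁ = ∑_{d,e ≤ N} a(d)ā(e)/[d,e]`. [cite: Radziwill2012, §7 (7.2)] -/
def F1 (a : ℕ → ℂ) : ℂ :=
  ∑ d ∈ Icc 1 N, ∑ e ∈ Icc 1 N, a d * conj (a e) / (Nat.lcm d e : ℂ)

/-- `F₂ = ∑_{d,e ≤ N} a(d)ā(e)/[d,e] · log([d,e]/(d,e))`. [cite: Radziwill2012, §7 (7.1)] -/
def F2 (a : ℕ → ℂ) : ℂ :=
  ∑ d ∈ Icc 1 N, ∑ e ∈ Icc 1 N,
    a d * conj (a e) / (Nat.lcm d e : ℂ) * (Real.log ((Nat.lcm d e : ℝ) / (Nat.gcd d e : ℝ)) : ℂ)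

variable {N}

/-! ### Reindexing over multiples -/

/-- `∑_{d ≤ N, ℓ ∣ d} f(d) = ∑_{d' ≤ N/ℓ} f(d'ℓ)` for `1 ≤ ℓ ≤ N`. [folklore] -/
theorem sum_Icc_ite_dvd {M : Type*} [AddCommMonoid M] (f : ℕ → M) {ℓ : ℕ} (hℓ : ℓ ∈ Icc 1 N) :
    ∑ d ∈ Icc 1 N, (if ℓ ∣ d then f d else 0) = ∑ d ∈ Icc 1 (N / ℓ), f (d * ℓ) := by
  have key := sum_Icc_sum_divisorsAntidiagonal (fun m e => if m = ℓ then f (m * e) else 0) N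
  have hL : ∀ n ∈ Icc 1 N, ∑ q ∈ n.divisorsAntidiagonal, (if q.1 = ℓ then f (q.1 * q.2) else 0) =
      if ℓ ∣ n then f n else 0 := by
    intro n hn
    have hn0 : n ≠ 0 := by have := (mem_Icc.1 hn).1; omega
    rw [Nat.sum_divisorsAntidiagonal (fun i j => if i = ℓ then f (i * j) else 0)]
    rw [Finset.sum_ite_eq' n.divisors ℓ (fun i => f (i * (n / i)))]
    by_cases h : ℓ ∣ n
    · rw [if_pos (Nat.mem_divisors.2 ⟨h, hn0⟩), if_pos h, Nat.mul_div_cancel' h]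
    · rw [if_neg (fun h' => h (Nat.dvd_of_mem_divisors h')), if_neg h]
  rw [Finset.sum_congr rfl hL] at key
  rw [key]
  rw [Finset.sum_eq_single_of_mem ℓ hℓ (fun b _ hb => by simp [hb])]
  simp only [if_true]
  exact Finset.sum_congr rfl fun e _ => by rw [mul_comm]

/-- `∑_{ℓ ≤ N} ∑_{m ≤ N/ℓ} F(ℓ, m) = ∑_{k ≤ N} ∑_{ℓ m = k} F(ℓ, m)` (the hyperbola rearrangement,
read backwards). [folklore] -/
theorem sum_Icc_sum_Icc_div_eq {M : Type*} [AddCommMonoid M] (F : ℕ → ℕ → M) :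
    ∑ ℓ ∈ Icc 1 N, ∑ m ∈ Icc 1 (N / ℓ), F ℓ m =
      ∑ k ∈ Icc 1 N, ∑ q ∈ k.divisorsAntidiagonal, F q.1 q.2 :=
  (sum_Icc_sum_divisorsAntidiagonal F N).symm

/-! ### Möbius inversion: `∑ μ(ℓ) y(ℓ)/ℓ = a(1)` -/

/-- `∑_{ℓ ∣ n} μ(ℓ) = [n = 1]` in `ℂ`. [folklore] -/
theorem sum_divisors_moebius_complex (n : ℕ) :
    ∑ ℓ ∈ n.divisors, (μ ℓ : ℂ) = if n = 1 then 1 else 0 := by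
  have h := congrArg (fun f : ArithmeticFunction ℂ => f n)
    (coe_moebius_mul_coe_zeta : (μ * ζ : ArithmeticFunction ℂ) = 1)
  simp only [coe_mul_zeta_apply, intCoe_apply, one_apply] at h
  rw [h]

/-- **Möbius inversion for `y`**: `∑_{ℓ ≤ N} μ(ℓ) y(ℓ)/ℓ = a(1)` (`N ≥ 1`).
[cite: Radziwill2012, §7 ("By Moebius inversion")] -/
theorem sum_moebius_mul_yv_div (a : ℕ → ℂ) (hN : 1 ≤ N) :
    ∑ ℓ ∈ Icc 1 N, (μ ℓ : ℂ) * yv N a ℓ / ℓ = a 1 := by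
  have h1 : ∀ ℓ ∈ Icc 1 N, (μ ℓ : ℂ) * yv N a ℓ / ℓ =
      ∑ d ∈ Icc 1 (N / ℓ), (μ ℓ : ℂ) * a (ℓ * d) / ((ℓ : ℂ) * d) := by
    intro ℓ hℓ
    unfold yv
    rw [Finset.mul_sum, Finset.sum_div]
    refine Finset.sum_congr rfl fun d hd => ?_
    rw [mul_comm d ℓ]
    ring
  rw [Finset.sum_congr rfl h1, sum_Icc_sum_Icc_div_eq (fun ℓ d => (μ ℓ : ℂ) * a (ℓ * d) / ((ℓ : ℂ) * d))]
  have h2' : ∀ k ∈ Icc 1 N, ∑ q ∈ k.divisorsAntidiagonal, (μ q.1 : ℂ) * a (q.1 * q.2) / ((q.1 : ℂ) * q.2) =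
      a k / k * ∑ ℓ ∈ k.divisors, (μ ℓ : ℂ) := by
    intro k hk
    rw [Nat.sum_divisorsAntidiagonal (fun i j => (μ i : ℂ) * a (i * j) / ((i : ℂ) * j)),
      Finset.mul_sum]
    refine Finset.sum_congr rfl fun ℓ hℓ => ?_
    have hdvd := Nat.dvd_of_mem_divisors hℓ
    rw [← Nat.cast_mul, Nat.mul_div_cancel' hdvd]
    ring
  rw [Finset.sum_congr rfl h2']
  have h3 : ∀ k ∈ Icc 1 N, a k / k * ∑ ℓ ∈ k.divisors, (μ ℓ : ℂ) = if k = 1 then a 1 else 0 := by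
    intro k hk
    rw [sum_divisors_moebius_complex k]
    split_ifs with h
    · subst h; simp
    · simp
  rw [Finset.sum_congr rfl h3, Finset.sum_ite_eq']
  rw [if_pos (by simp [hN])]

/-! ### The diagonalisation `∑_{d,e} u(d)v̄(e)/(de) ∑_{ℓ ∣ (d,e)} H(ℓ) = ∑_ℓ H(ℓ)/ℓ² Y_u(ℓ) Ȳ_v(ℓ)` -/

/-- The divisors of `(d, e)` as the `ℓ ≤ N` with `ℓ ∣ d`, `ℓ ∣ e` (`1 ≤ d, e ≤ N`). [folklore] -/
theorem sum_divisors_gcd_eq_sum_Icc_ite {M : Type*} [AddCommMonoid M] (H : ℕ → M) {d e : ℕ}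
    (hd : d ∈ Icc 1 N) (he : e ∈ Icc 1 N) :
    ∑ ℓ ∈ (Nat.gcd d e).divisors, H ℓ = ∑ ℓ ∈ Icc 1 N, if ℓ ∣ d ∧ ℓ ∣ e then H ℓ else 0 := by
  rw [← Finset.sum_filter]
  apply Finset.sum_congr _ (fun _ _ => rfl)
  ext ℓ
  simp only [Nat.mem_divisors, Finset.mem_filter, mem_Icc, Nat.dvd_gcd_iff]
  obtain ⟨hd1, hdN⟩ := mem_Icc.1 hd
  obtain ⟨he1, _⟩ := mem_Icc.1 he
  constructor
  · rintro ⟨⟨h1, h2⟩, _⟩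
    have hℓpos : 0 < ℓ := Nat.pos_of_dvd_of_pos h1 (by omega)
    have hℓd : ℓ ≤ d := Nat.le_of_dvd (by omega) h1
    exact ⟨⟨hℓpos, by omega⟩, h1, h2⟩
  · rintro ⟨⟨_, _⟩, h3, h4⟩
    exact ⟨⟨h3, h4⟩, Nat.gcd_ne_zero_left (by omega)⟩

/-- **Diagonalisation of the forms of §7**: for any weights `H`,
`∑_{d,e ≤ N} u(d) v̄(e)/(de) · ∑_{ℓ ∣ (d,e)} H(ℓ) = ∑_{ℓ ≤ N} H(ℓ)/ℓ² · Y_u(ℓ) Ȳ_v(ℓ)` with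
`Y_u(ℓ) = ∑_{d ≤ N/ℓ} u(dℓ)/d` (the step "(d,e) = ∑_{ℓ∣d,ℓ∣e} φ(ℓ) diagonalizes the first quadratic
form", eq. (7.2), in general form). [cite: Radziwill2012, §7 eq. (7.2)] -/
theorem diag_identity (H : ℕ → ℂ) (u v : ℕ → ℂ) :
    ∑ d ∈ Icc 1 N, ∑ e ∈ Icc 1 N, u d * conj (v e) / ((d : ℂ) * e) *
        ∑ ℓ ∈ (Nat.gcd d e).divisors, H ℓ =
      ∑ ℓ ∈ Icc 1 N, H ℓ / (ℓ : ℂ) ^ 2 * (yv N u ℓ * conj (yv N v ℓ)) := by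
  set X : ℕ → ℕ → ℂ := fun ℓ d => if ℓ ∣ d then u d / d else 0 with hX
  set Y : ℕ → ℕ → ℂ := fun ℓ e => if ℓ ∣ e then conj (v e) / e else 0 with hY
  have hA : ∀ d ∈ Icc 1 N, ∀ e ∈ Icc 1 N, u d * conj (v e) / ((d : ℂ) * e) *
      ∑ ℓ ∈ (Nat.gcd d e).divisors, H ℓ = ∑ ℓ ∈ Icc 1 N, H ℓ * (X ℓ d * Y ℓ e) := by
    intro d hd e he
    rw [sum_divisors_gcd_eq_sum_Icc_ite H hd he, Finset.mul_sum]
    refine Finset.sum_congr rfl fun ℓ _ => ?_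
    simp only [hX, hY]
    by_cases h1 : ℓ ∣ d
    · by_cases h2 : ℓ ∣ e
      · rw [if_pos ⟨h1, h2⟩, if_pos h1, if_pos h2]; ring
      · rw [if_neg (fun h => h2 h.2), if_neg h2]; ring
    · rw [if_neg (fun h => h1 h.1), if_neg h1]; ring
  have hB : ∑ d ∈ Icc 1 N, ∑ e ∈ Icc 1 N, u d * conj (v e) / ((d : ℂ) * e) *
        ∑ ℓ ∈ (Nat.gcd d e).divisors, H ℓ =
      ∑ ℓ ∈ Icc 1 N, H ℓ * ((∑ d ∈ Icc 1 N, X ℓ d) * ∑ e ∈ Icc 1 N, Y ℓ e) := by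
    calc ∑ d ∈ Icc 1 N, ∑ e ∈ Icc 1 N, u d * conj (v e) / ((d : ℂ) * e) *
          ∑ ℓ ∈ (Nat.gcd d e).divisors, H ℓ
        = ∑ d ∈ Icc 1 N, ∑ e ∈ Icc 1 N, ∑ ℓ ∈ Icc 1 N, H ℓ * (X ℓ d * Y ℓ e) := by
          refine Finset.sum_congr rfl fun d hd => Finset.sum_congr rfl fun e he => hA d hd e he
      _ = ∑ d ∈ Icc 1 N, ∑ ℓ ∈ Icc 1 N, ∑ e ∈ Icc 1 N, H ℓ * (X ℓ d * Y ℓ e) := by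
          refine Finset.sum_congr rfl fun d _ => Finset.sum_comm
      _ = ∑ ℓ ∈ Icc 1 N, ∑ d ∈ Icc 1 N, ∑ e ∈ Icc 1 N, H ℓ * (X ℓ d * Y ℓ e) := Finset.sum_comm
      _ = ∑ ℓ ∈ Icc 1 N, H ℓ * ((∑ d ∈ Icc 1 N, X ℓ d) * ∑ e ∈ Icc 1 N, Y ℓ e) := by
          refine Finset.sum_congr rfl fun ℓ _ => ?_
          rw [Finset.sum_mul_sum, Finset.mul_sum]
          refine Finset.sum_congr rfl fun d _ => ?_
          rw [Finset.mul_sum]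
  rw [hB]
  refine Finset.sum_congr rfl fun ℓ hℓ => ?_
  have hℓ0 : (ℓ : ℂ) ≠ 0 := by
    have := (mem_Icc.1 hℓ).1
    exact_mod_cast (show ℓ ≠ 0 by omega)
  have hXs : ∑ d ∈ Icc 1 N, X ℓ d = yv N u ℓ / ℓ := by
    simp only [hX]
    rw [sum_Icc_ite_dvd (fun d => u d / d) hℓ]
    unfold yv
    rw [Finset.sum_div]
    refine Finset.sum_congr rfl fun d _ => ?_
    push_cast
    ring
  have hYs : ∑ e ∈ Icc 1 N, Y ℓ e = conj (yv N v ℓ) / ℓ := by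
    simp only [hY]
    rw [sum_Icc_ite_dvd (fun e => conj (v e) / e) hℓ]
    unfold yv
    rw [map_sum, Finset.sum_div]
    refine Finset.sum_congr rfl fun e _ => ?_
    rw [map_div₀, Complex.conj_natCast]
    push_cast
    ring
  rw [hXs, hYs]
  field_simp

/-! ### Lemma 9: `F₁ = ∑ φ(ℓ)/ℓ² |y(ℓ)|² = 1/G + D` -/

/-- `G > 0` (`N ≥ 1`: the term `n = 1` is `1`). [folklore] -/
theorem Gs_pos (hN : 1 ≤ N) : 0 < Gs N := by
  unfold Gs
  have h1 : (1 : ℕ) ∈ Icc 1 N := by simp [hN]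
  rw [← Finset.add_sum_erase _ _ h1]
  have : ((μ 1 : ℝ)) ^ 2 / ((1 : ℕ).totient : ℝ) = 1 := by simp
  rw [this]
  have : 0 ≤ ∑ n ∈ (Icc 1 N).erase 1, ((μ n : ℝ)) ^ 2 / (n.totient : ℝ) :=
    Finset.sum_nonneg fun n _ => by positivity
  linarith

/-- `1/[d,e] = (d,e)/(de)` and `(d,e) = ∑_{ℓ ∣ (d,e)} φ(ℓ)`: the summand of `F₁` in the form to
which `diag_identity` applies. [folklore] -/
theorem div_lcm_eq {d e : ℕ} (hd : d ≠ 0) (he : e ≠ 0) (x : ℂ) :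
    x / (Nat.lcm d e : ℂ) = x / ((d : ℂ) * e) * ∑ ℓ ∈ (Nat.gcd d e).divisors, (ℓ.totient : ℂ) := by
  have hsum : ∑ ℓ ∈ (Nat.gcd d e).divisors, (ℓ.totient : ℂ) = (Nat.gcd d e : ℂ) := by
    rw [← Nat.cast_sum, Nat.sum_totient]
  rw [hsum]
  have hlcm : (Nat.lcm d e : ℂ) ≠ 0 := by exact_mod_cast Nat.lcm_ne_zero hd he
  have hde : ((d : ℂ) * e) ≠ 0 := by
    apply mul_ne_zero <;> exact_mod_cast (by assumption)
  have key : (Nat.gcd d e : ℂ) * (Nat.lcm d e : ℂ) = (d : ℂ) * e := by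
    rw [← Nat.cast_mul, Nat.gcd_mul_lcm, Nat.cast_mul]
  field_simp
  rw [mul_assoc x, ← key]
  ring

/-- **First half of Lemma 9** (eq. (7.2)): `F₁ = ∑_{ℓ ≤ N} φ(ℓ)/ℓ² |y(ℓ)|²`.
[cite: Radziwill2012, §7 eq. (7.2)] -/
theorem F1_eq (a : ℕ → ℂ) :
    F1 N a = ((∑ ℓ ∈ Icc 1 N, (ℓ.totient : ℝ) / (ℓ : ℝ) ^ 2 * ‖yv N a ℓ‖ ^ 2 : ℝ) : ℂ) := by
  unfold F1
  have h1 : ∀ d ∈ Icc 1 N, ∀ e ∈ Icc 1 N, a d * conj (a e) / (Nat.lcm d e : ℂ) =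
      a d * conj (a e) / ((d : ℂ) * e) * ∑ ℓ ∈ (Nat.gcd d e).divisors, ((ℓ.totient : ℕ) : ℂ) := by
    intro d hd e he
    have hd0 : d ≠ 0 := by have := (mem_Icc.1 hd).1; omega
    have he0 : e ≠ 0 := by have := (mem_Icc.1 he).1; omega
    exact div_lcm_eq hd0 he0 _
  rw [Finset.sum_congr rfl fun d hd => Finset.sum_congr rfl fun e he => h1 d hd e he]
  rw [diag_identity (fun ℓ => ((ℓ.totient : ℕ) : ℂ)) a a]
  push_cast
  refine Finset.sum_congr rfl fun ℓ _ => ?_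
  rw [Complex.mul_conj, Complex.normSq_eq_norm_sq]
  push_cast
  ring

/-- `∑_{ℓ ≤ N} φ(ℓ)/ℓ² z(ℓ)² = 1/G`. [cite: Radziwill2012, proof of Lemma 9] -/
theorem sum_totient_div_sq_mul_zv_sq (hN : 1 ≤ N) :
    ∑ ℓ ∈ Icc 1 N, (ℓ.totient : ℝ) / (ℓ : ℝ) ^ 2 * zv N ℓ ^ 2 = 1 / Gs N := by
  have hG := (Gs_pos hN).ne'
  have h1 : ∀ ℓ ∈ Icc 1 N, (ℓ.totient : ℝ) / (ℓ : ℝ) ^ 2 * zv N ℓ ^ 2 =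
      (1 / Gs N ^ 2) * (((μ ℓ : ℝ)) ^ 2 / (ℓ.totient : ℝ)) := by
    intro ℓ hℓ
    have hℓ1 : 1 ≤ ℓ := (mem_Icc.1 hℓ).1
    have hℓ0 : (ℓ : ℝ) ≠ 0 := by exact_mod_cast (show ℓ ≠ 0 by omega)
    have hφ : (ℓ.totient : ℝ) ≠ 0 := by exact_mod_cast (Nat.totient_pos.2 hℓ1).ne'
    unfold zv
    field_simp
  rw [Finset.sum_congr rfl h1, ← Finset.mul_sum]
  unfold Gs at hG ⊢
  field_simp

/-- `∑_{ℓ ≤ N} φ(ℓ)/ℓ² z(ℓ) Re y(ℓ) = 1/G` (Möbius inversion, `a(1) = 1`).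
[cite: Radziwill2012, proof of Lemma 9] -/
theorem sum_totient_div_sq_mul_zv_mul_re (a : ℕ → ℂ) (ha : a 1 = 1) (hN : 1 ≤ N) :
    ∑ ℓ ∈ Icc 1 N, (ℓ.totient : ℝ) / (ℓ : ℝ) ^ 2 * zv N ℓ * (yv N a ℓ).re = 1 / Gs N := by
  have hG := (Gs_pos hN).ne'
  have h1 : ∀ ℓ ∈ Icc 1 N, (ℓ.totient : ℝ) / (ℓ : ℝ) ^ 2 * zv N ℓ * (yv N a ℓ).re =
      (1 / Gs N) * ((μ ℓ : ℂ) * yv N a ℓ / ℓ).re := by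
    intro ℓ hℓ
    have hℓ1 : 1 ≤ ℓ := (mem_Icc.1 hℓ).1
    have hℓ0 : (ℓ : ℝ) ≠ 0 := by exact_mod_cast (show ℓ ≠ 0 by omega)
    have hφ : (ℓ.totient : ℝ) ≠ 0 := by exact_mod_cast (Nat.totient_pos.2 hℓ1).ne'
    have hre : ((μ ℓ : ℂ) * yv N a ℓ / ℓ).re = (μ ℓ : ℝ) * (yv N a ℓ).re / ℓ := by
      have : (μ ℓ : ℂ) * yv N a ℓ / ℓ = (((μ ℓ : ℝ) / ℓ : ℝ) : ℂ) * yv N a ℓ := by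
        push_cast; ring
      rw [this, Complex.re_ofReal_mul]
      ring
    rw [hre]
    unfold zv
    field_simp
  rw [Finset.sum_congr rfl h1, ← Finset.mul_sum, ← Complex.re_sum, sum_moebius_mul_yv_div a hN,
    ha, Complex.one_re, mul_one]

/-- **Lemma 9 (Radziwiłł 2012)**: `F₁ = ∑_{d,e ≤ N} a(d)ā(e)/[d,e] = 1/G + D`, i.e.
`D = ∑ φ(ℓ)/ℓ²|y(ℓ) − z(ℓ)|² = Re F₁ − 1/G` (for `a(1) = 1`). [cite: Radziwill2012, Lemma 9] -/
theorem Dv_eq (a : ℕ → ℂ) (ha : a 1 = 1) (hN : 1 ≤ N) : Dv N a = (F1 N a).re - 1 / Gs N := by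
  have hsq : ∀ ℓ ∈ Icc 1 N, (ℓ.totient : ℝ) / (ℓ : ℝ) ^ 2 * ‖wv N a ℓ‖ ^ 2 =
      (ℓ.totient : ℝ) / (ℓ : ℝ) ^ 2 * ‖yv N a ℓ‖ ^ 2 +
        (ℓ.totient : ℝ) / (ℓ : ℝ) ^ 2 * zv N ℓ ^ 2 -
        2 * ((ℓ.totient : ℝ) / (ℓ : ℝ) ^ 2 * zv N ℓ * (yv N a ℓ).re) := by
    intro ℓ _
    unfold wv
    rw [← Complex.normSq_eq_norm_sq, ← Complex.normSq_eq_norm_sq, Complex.normSq_sub,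
      Complex.normSq_ofReal, Complex.conj_ofReal, Complex.re_mul_ofReal]
    ring
  unfold Dv
  rw [Finset.sum_congr rfl hsq, Finset.sum_sub_distrib, Finset.sum_add_distrib, ← Finset.mul_sum,
    sum_totient_div_sq_mul_zv_sq hN, sum_totient_div_sq_mul_zv_mul_re a ha hN, F1_eq,
    Complex.ofReal_re]
  ring

/-! ### Arithmetic functions: `φ`, the derivation `f ↦ f·log`, and `h = φ·log + φ ⋆ Λ` -/

/-- Euler's `φ` as a real arithmetic function. [folklore] -/
def phiR : ArithmeticFunction ℝ := ⟨fun n => (n.totient : ℝ), by simp⟩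

/-- Unfolding lemma. [folklore] -/
@[simp] theorem phiR_apply (n : ℕ) : phiR n = (n.totient : ℝ) := rfl

/-- `n ↦ n` as a real arithmetic function. [folklore] -/
def idR : ArithmeticFunction ℝ := ⟨fun n => (n : ℝ), by simp⟩

/-- Unfolding lemma. [folklore] -/
@[simp] theorem idR_apply (n : ℕ) : idR n = (n : ℝ) := rfl

/-- The derivation `D f = f · log` of the Dirichlet ring. [folklore] -/
def Dlog (f : ArithmeticFunction ℝ) : ArithmeticFunction ℝ := f.pmul log

/-- Unfolding lemma. [folklore] -/
@[simp] theorem Dlog_apply (f : ArithmeticFunction ℝ) (n : ℕ) : Dlog f n = f n * Real.log n := by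
  simp [Dlog, pmul_apply, log_apply]

/-- `D` is a derivation: `D(f ⋆ g) = Df ⋆ g + f ⋆ Dg` (since `log(ab) = log a + log b`).
[folklore] -/
theorem Dlog_mul (f g : ArithmeticFunction ℝ) : Dlog (f * g) = Dlog f * g + f * Dlog g := by
  ext n
  simp only [Dlog_apply, ArithmeticFunction.add_apply, ArithmeticFunction.mul_apply, Finset.sum_mul]
  rw [← Finset.sum_add_distrib]
  refine Finset.sum_congr rfl fun q hq => ?_
  obtain ⟨hq, hn⟩ := Nat.mem_divisorsAntidiagonal.1 hq
  have h1 : q.1 ≠ 0 := by rintro h; rw [h, zero_mul] at hq; exact hn hq.symm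
  have h2 : q.2 ≠ 0 := by rintro h; rw [h, mul_zero] at hq; exact hn hq.symm
  rw [← hq, Nat.cast_mul, Real.log_mul (Nat.cast_ne_zero.2 h1) (Nat.cast_ne_zero.2 h2)]
  ring

/-- `Dζ = log`. [folklore] -/
theorem Dlog_zeta : Dlog (ζ : ArithmeticFunction ℝ) = ArithmeticFunction.log := by
  ext n
  rw [Dlog_apply, natCoe_apply, zeta_apply, log_apply]
  split_ifs with h
  · subst h; simp
  · simp

/-- `φ ⋆ ζ = id` (`∑_{d ∣ n} φ(d) = n`). [folklore] -/
theorem phiR_mul_zeta : phiR * (ζ : ArithmeticFunction ℝ) = idR := by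
  ext n
  rw [coe_mul_zeta_apply, idR_apply]
  simp only [phiR_apply]
  rw [← Nat.cast_sum, Nat.sum_totient]

/-- `h = φ·log + φ ⋆ Λ`, the arithmetic function with `∑_{ℓ ∣ n} h(ℓ) = n log n`. [folklore] -/
def hAF : ArithmeticFunction ℝ := Dlog phiR + phiR * Λ

/-- `h ⋆ ζ = D(id)`, i.e. `∑_{ℓ ∣ n} h(ℓ) = n log n`. [folklore] -/
theorem hAF_mul_zeta : hAF * (ζ : ArithmeticFunction ℝ) = Dlog idR := by
  rw [hAF, add_mul, mul_assoc, vonMangoldt_mul_zeta, ← Dlog_zeta, ← Dlog_mul, phiR_mul_zeta]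

/-- `∑_{ℓ ∣ n} h(ℓ) = n log n`. [folklore] -/
theorem sum_divisors_hAF (n : ℕ) : ∑ ℓ ∈ n.divisors, hAF ℓ = (n : ℝ) * Real.log n := by
  have h := congrArg (fun f : ArithmeticFunction ℝ => f n) hAF_mul_zeta
  simp only [coe_mul_zeta_apply, Dlog_apply, idR_apply] at h
  exact h

/-- `h(n) ≥ φ(n) log n` (as `φ ⋆ Λ ≥ 0`). [folklore] -/
theorem totient_mul_log_le_hAF (n : ℕ) : (n.totient : ℝ) * Real.log n ≤ hAF n := by
  rw [hAF, ArithmeticFunction.add_apply, Dlog_apply, phiR_apply, ArithmeticFunction.mul_apply]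
  have : 0 ≤ ∑ x ∈ n.divisorsAntidiagonal, phiR x.1 * Λ x.2 :=
    Finset.sum_nonneg fun q _ => mul_nonneg (by simp) vonMangoldt_nonneg
  linarith

/-! ### The second form: `Re F₂ ≤ 2 Re B(y, y)` -/

/-- `y` for the coefficients `a·log`: `Y_{a log}(ℓ) = log ℓ · y(ℓ) + ∑_{m ≤ N/ℓ} Λ(m)/m · y(mℓ)`
(`log d = ∑_{m ∣ d} Λ(m)` and the hyperbola rearrangement). [cite: Radziwill2012, Lemma 11] -/
theorem yv_mul_log (a : ℕ → ℂ) {ℓ : ℕ} (hℓ : 1 ≤ ℓ) :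
    yv N (fun n => a n * (Real.log n : ℂ)) ℓ =
      (Real.log ℓ : ℂ) * yv N a ℓ +
        ∑ m ∈ Icc 1 (N / ℓ), ((Λ m / m : ℝ) : ℂ) * yv N a (m * ℓ) := by
  have hℓ0 : (ℓ : ℝ) ≠ 0 := by exact_mod_cast (show ℓ ≠ 0 by omega)
  -- split `log(dℓ) = log d + log ℓ`
  have h1 : yv N (fun n => a n * (Real.log n : ℂ)) ℓ =
      (Real.log ℓ : ℂ) * yv N a ℓ + ∑ d ∈ Icc 1 (N / ℓ), a (d * ℓ) / (d : ℂ) * (Real.log d : ℂ) := by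
    unfold yv
    rw [Finset.mul_sum, ← Finset.sum_add_distrib]
    refine Finset.sum_congr rfl fun d hd => ?_
    have hd0 : (d : ℝ) ≠ 0 := by
      have := (mem_Icc.1 hd).1; exact_mod_cast (show d ≠ 0 by omega)
    simp only []
    rw [Nat.cast_mul, Real.log_mul hd0 hℓ0]
    push_cast
    ring
  rw [h1]
  congr 1
  -- `∑_d a(dℓ)/d log d = ∑_m Λ(m)/m y(mℓ)`
  have h2 : ∀ d ∈ Icc 1 (N / ℓ), a (d * ℓ) / (d : ℂ) * (Real.log d : ℂ) =
      ∑ q ∈ d.divisorsAntidiagonal, (Λ q.1 : ℂ) * (a (q.1 * q.2 * ℓ) / ((q.1 : ℂ) * q.2)) := by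
    intro d hd
    have hd0 : d ≠ 0 := by have := (mem_Icc.1 hd).1; omega
    have : ∀ q ∈ d.divisorsAntidiagonal,
        (Λ q.1 : ℂ) * (a (q.1 * q.2 * ℓ) / ((q.1 : ℂ) * q.2)) = (Λ q.1 : ℂ) * (a (d * ℓ) / d) := by
      intro q hq
      have hq' := (Nat.mem_divisorsAntidiagonal.1 hq).1
      rw [← Nat.cast_mul, hq']
    rw [Finset.sum_congr rfl this, ← Finset.sum_mul, ← vonMangoldt_sum]
    rw [Nat.sum_divisorsAntidiagonal (fun i _ => (Λ i : ℂ))]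
    push_cast
    ring
  rw [Finset.sum_congr rfl h2,
    sum_Icc_sum_divisorsAntidiagonal (fun m e => (Λ m : ℂ) * (a (m * e * ℓ) / ((m : ℂ) * e))) (N / ℓ)]
  refine Finset.sum_congr rfl fun m hm => ?_
  have hm0 : (m : ℂ) ≠ 0 := by
    have := (mem_Icc.1 hm).1; exact_mod_cast (show m ≠ 0 by omega)
  rw [Nat.div_div_eq_div_mul, mul_comm ℓ m]
  unfold yv
  rw [Finset.mul_sum]
  refine Finset.sum_congr rfl fun e _ => ?_
  rw [show m * e * ℓ = e * (m * ℓ) by ring]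
  push_cast
  field_simp

/-- `log([d,e]/(d,e)) = log d + log e − 2 log (d,e)`. [folklore] -/
theorem log_lcm_div_gcd {d e : ℕ} (hd : d ≠ 0) (he : e ≠ 0) :
    Real.log ((Nat.lcm d e : ℝ) / (Nat.gcd d e : ℝ)) =
      Real.log d + Real.log e - 2 * Real.log (Nat.gcd d e) := by
  have hg : (Nat.gcd d e : ℝ) ≠ 0 := by exact_mod_cast Nat.gcd_ne_zero_left hd
  have hl : (Nat.lcm d e : ℝ) ≠ 0 := by exact_mod_cast Nat.lcm_ne_zero hd he
  have hd' : (d : ℝ) ≠ 0 := by exact_mod_cast hd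
  have he' : (e : ℝ) ≠ 0 := by exact_mod_cast he
  have key : (Nat.gcd d e : ℝ) * (Nat.lcm d e : ℝ) = (d : ℝ) * e := by
    rw [← Nat.cast_mul, Nat.gcd_mul_lcm, Nat.cast_mul]
  have hlcm : (Nat.lcm d e : ℝ) = d * e / Nat.gcd d e := by
    field_simp; rw [mul_comm]; exact key
  rw [hlcm, div_div, Real.log_div (mul_ne_zero hd' he') (mul_ne_zero hg hg), Real.log_mul hd' he',
    Real.log_mul hg hg]
  ring

/-- The summand of `F₂`: `a(d)ā(e)/[d,e] · log([d,e]/(d,e)) =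
(a log)(d) ā(e)/(de)·∑_{ℓ∣(d,e)} φ(ℓ) + a(d) conj((a log)(e))/(de)·∑_{ℓ∣(d,e)} φ(ℓ)
− 2 a(d)ā(e)/(de)·∑_{ℓ∣(d,e)} h(ℓ)`. [cite: Radziwill2012, Lemma 11] -/
theorem F2_summand_eq (a : ℕ → ℂ) {d e : ℕ} (hd : d ≠ 0) (he : e ≠ 0) :
    a d * conj (a e) / (Nat.lcm d e : ℂ) * (Real.log ((Nat.lcm d e : ℝ) / (Nat.gcd d e : ℝ)) : ℂ) =
      (a d * (Real.log d : ℂ)) * conj (a e) / ((d : ℂ) * e) *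
          ∑ ℓ ∈ (Nat.gcd d e).divisors, ((ℓ.totient : ℝ) : ℂ) +
        a d * conj (a e * (Real.log e : ℂ)) / ((d : ℂ) * e) *
          ∑ ℓ ∈ (Nat.gcd d e).divisors, ((ℓ.totient : ℝ) : ℂ) -
        2 * (a d * conj (a e) / ((d : ℂ) * e) * ∑ ℓ ∈ (Nat.gcd d e).divisors, (hAF ℓ : ℂ)) := by
  rw [log_lcm_div_gcd hd he]
  have hφ : ∑ ℓ ∈ (Nat.gcd d e).divisors, ((ℓ.totient : ℝ) : ℂ) = (Nat.gcd d e : ℂ) := by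
    norm_cast; rw [Nat.sum_totient]
  have hh : ∑ ℓ ∈ (Nat.gcd d e).divisors, (hAF ℓ : ℂ) =
      (Nat.gcd d e : ℂ) * (Real.log (Nat.gcd d e) : ℂ) := by
    rw [← Complex.ofReal_sum, sum_divisors_hAF]; push_cast; ring
  rw [hφ, hh]
  have hg : (Nat.gcd d e : ℂ) ≠ 0 := by exact_mod_cast Nat.gcd_ne_zero_left hd
  have hl : (Nat.lcm d e : ℂ) ≠ 0 := by exact_mod_cast Nat.lcm_ne_zero hd he
  have hd' : (d : ℂ) ≠ 0 := by exact_mod_cast hd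
  have he' : (e : ℂ) ≠ 0 := by exact_mod_cast he
  have key : (Nat.gcd d e : ℂ) * (Nat.lcm d e : ℂ) = (d : ℂ) * e := by
    rw [← Nat.cast_mul, Nat.gcd_mul_lcm, Nat.cast_mul]
  have hlcm : (Nat.lcm d e : ℂ) = d * e / Nat.gcd d e := by
    field_simp; rw [mul_comm]; exact key
  rw [hlcm, map_mul, Complex.conj_ofReal]
  push_cast
  field_simp

/-- **The second quadratic form is dominated by the bilinear form `B`**:
`Re F₂ ≤ 2 Re B(y, y)`, where `F₂ = ∑ a(d)ā(e)/[d,e] log([d,e]/(d,e))` and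
`B(u,v) = ∑_{ℓ} ∑_{m ≤ N/ℓ} φ(ℓ)Λ(m)/(ℓ²m) u(mℓ)v̄(ℓ)`. This is the identity of Lemma 11 with its
error term identified exactly: `F₂ = 2 Re B(y,y) − 2∑_ℓ (φ ⋆ Λ)(ℓ)/ℓ² |y(ℓ)|²`, and the last sum
is nonnegative. [cite: Radziwill2012, Lemma 11] -/
theorem re_F2_le (a : ℕ → ℂ) : (F2 N a).re ≤ 2 * (Bf N (yv N a) (yv N a)).re := by
  set aL : ℕ → ℂ := fun n => a n * (Real.log n : ℂ) with haL
  -- rewrite `F₂` through the three diagonal sums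
  have hF2 : F2 N a =
      ∑ ℓ ∈ Icc 1 N, ((ℓ.totient : ℝ) : ℂ) / (ℓ : ℂ) ^ 2 * (yv N aL ℓ * conj (yv N a ℓ)) +
        ∑ ℓ ∈ Icc 1 N, ((ℓ.totient : ℝ) : ℂ) / (ℓ : ℂ) ^ 2 * (yv N a ℓ * conj (yv N aL ℓ)) -
        2 * ∑ ℓ ∈ Icc 1 N, (hAF ℓ : ℂ) / (ℓ : ℂ) ^ 2 * (yv N a ℓ * conj (yv N a ℓ)) := by
    rw [← diag_identity (fun ℓ => ((ℓ.totient : ℝ) : ℂ)) aL a,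
      ← diag_identity (fun ℓ => ((ℓ.totient : ℝ) : ℂ)) a aL,
      ← diag_identity (fun ℓ => (hAF ℓ : ℂ)) a a, Finset.mul_sum, ← Finset.sum_add_distrib,
      ← Finset.sum_sub_distrib]
    unfold F2
    refine Finset.sum_congr rfl fun d hd => ?_
    rw [Finset.mul_sum, ← Finset.sum_add_distrib, ← Finset.sum_sub_distrib]
    refine Finset.sum_congr rfl fun e he => ?_
    have hd0 : d ≠ 0 := by have := (mem_Icc.1 hd).1; omega
    have he0 : e ≠ 0 := by have := (mem_Icc.1 he).1; omega
    rw [F2_summand_eq a hd0 he0]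
  -- `Y_{a log}` in terms of `y`
  have hY : ∀ ℓ ∈ Icc 1 N, yv N aL ℓ = (Real.log ℓ : ℂ) * yv N a ℓ +
      ∑ m ∈ Icc 1 (N / ℓ), ((Λ m / m : ℝ) : ℂ) * yv N a (m * ℓ) :=
    fun ℓ hℓ => yv_mul_log a (mem_Icc.1 hℓ).1
  -- real parts, term by term
  have hre1 : ∀ ℓ ∈ Icc 1 N,
      (((ℓ.totient : ℝ) : ℂ) / (ℓ : ℂ) ^ 2 * (yv N aL ℓ * conj (yv N a ℓ))).re =
        (ℓ.totient : ℝ) / (ℓ : ℝ) ^ 2 * Real.log ℓ * ‖yv N a ℓ‖ ^ 2 +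
          (∑ m ∈ Icc 1 (N / ℓ), ((((ℓ.totient : ℝ) * Λ m / ((ℓ : ℝ) ^ 2 * m) : ℝ) : ℂ) *
            (yv N a (m * ℓ) * conj (yv N a ℓ)))).re := by
    intro ℓ hℓ
    have hℓ0 : (ℓ : ℝ) ≠ 0 := by
      have := (mem_Icc.1 hℓ).1; exact_mod_cast (show ℓ ≠ 0 by omega)
    rw [hY ℓ hℓ, add_mul, mul_add, Complex.add_re, Finset.sum_mul, Finset.mul_sum]
    congr 1
    · have : ((ℓ.totient : ℝ) : ℂ) / (ℓ : ℂ) ^ 2 * ((Real.log ℓ : ℂ) * yv N a ℓ * conj (yv N a ℓ)) =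
          (((ℓ.totient : ℝ) / (ℓ : ℝ) ^ 2 * Real.log ℓ * ‖yv N a ℓ‖ ^ 2 : ℝ) : ℂ) := by
        rw [mul_assoc, Complex.mul_conj, Complex.normSq_eq_norm_sq]
        push_cast
        ring
      rw [this, Complex.ofReal_re]
    · congr 1
      refine Finset.sum_congr rfl fun m hm => ?_
      have hm0 : (m : ℝ) ≠ 0 := by
        have := (mem_Icc.1 hm).1; exact_mod_cast (show m ≠ 0 by omega)
      push_cast
      field_simp
  have hre2 : ∀ ℓ ∈ Icc 1 N,
      (((ℓ.totient : ℝ) : ℂ) / (ℓ : ℂ) ^ 2 * (yv N a ℓ * conj (yv N aL ℓ))).re =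
        (((ℓ.totient : ℝ) : ℂ) / (ℓ : ℂ) ^ 2 * (yv N aL ℓ * conj (yv N a ℓ))).re := by
    intro ℓ _
    have : ((ℓ.totient : ℝ) : ℂ) / (ℓ : ℂ) ^ 2 * (yv N a ℓ * conj (yv N aL ℓ)) =
        conj (((ℓ.totient : ℝ) : ℂ) / (ℓ : ℂ) ^ 2 * (yv N aL ℓ * conj (yv N a ℓ))) := by
      rw [map_mul, map_mul, map_div₀, Complex.conj_conj, Complex.conj_ofReal, map_pow,
        Complex.conj_natCast]
      ring
    rw [this, Complex.conj_re]
  have hre3 : ∀ ℓ ∈ Icc 1 N, ((hAF ℓ : ℂ) / (ℓ : ℂ) ^ 2 * (yv N a ℓ * conj (yv N a ℓ))).re =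
      hAF ℓ / (ℓ : ℝ) ^ 2 * ‖yv N a ℓ‖ ^ 2 := by
    intro ℓ _
    have : (hAF ℓ : ℂ) / (ℓ : ℂ) ^ 2 * (yv N a ℓ * conj (yv N a ℓ)) =
        ((hAF ℓ / (ℓ : ℝ) ^ 2 * ‖yv N a ℓ‖ ^ 2 : ℝ) : ℂ) := by
      rw [Complex.mul_conj, Complex.normSq_eq_norm_sq]; push_cast; ring
    rw [this, Complex.ofReal_re]
  -- the bound `h ≥ φ log`
  have hbound : ∀ ℓ ∈ Icc 1 N, (ℓ.totient : ℝ) / (ℓ : ℝ) ^ 2 * Real.log ℓ * ‖yv N a ℓ‖ ^ 2 ≤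
      hAF ℓ / (ℓ : ℝ) ^ 2 * ‖yv N a ℓ‖ ^ 2 := by
    intro ℓ _
    have h := totient_mul_log_le_hAF ℓ
    have h0 : 0 ≤ ‖yv N a ℓ‖ ^ 2 / (ℓ : ℝ) ^ 2 := by positivity
    calc (ℓ.totient : ℝ) / (ℓ : ℝ) ^ 2 * Real.log ℓ * ‖yv N a ℓ‖ ^ 2
        = (ℓ.totient : ℝ) * Real.log ℓ * (‖yv N a ℓ‖ ^ 2 / (ℓ : ℝ) ^ 2) := by ring
      _ ≤ hAF ℓ * (‖yv N a ℓ‖ ^ 2 / (ℓ : ℝ) ^ 2) := mul_le_mul_of_nonneg_right h h0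
      _ = hAF ℓ / (ℓ : ℝ) ^ 2 * ‖yv N a ℓ‖ ^ 2 := by ring
  -- assemble
  rw [hF2, Complex.sub_re, Complex.add_re, Complex.re_sum, Complex.re_sum,
    Finset.sum_congr rfl hre2, Finset.sum_congr rfl hre1, Complex.mul_re, Complex.re_sum,
    Finset.sum_congr rfl hre3]
  simp only [Complex.re_ofNat, Complex.im_ofNat, zero_mul, sub_zero]
  unfold Bf
  rw [Complex.re_sum, Finset.sum_add_distrib]
  have hsum := Finset.sum_le_sum hbound
  linarith

/-! ### Decomposition of `B(y, y)` along `y = z + w` -/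

/-- `z` as a complex sequence. [cite: Radziwill2012, §7] -/
def zC (N : ℕ) (ℓ : ℕ) : ℂ := (zv N ℓ : ℂ)

/-- Unfolding lemma. [folklore] -/
@[simp] theorem zC_apply (ℓ : ℕ) : zC N ℓ = (zv N ℓ : ℂ) := rfl

/-- `B` is additive in the first variable. [folklore] -/
theorem Bf_add_left (u₁ u₂ v : ℕ → ℂ) : Bf N (u₁ + u₂) v = Bf N u₁ v + Bf N u₂ v := by
  unfold Bf
  rw [← Finset.sum_add_distrib]
  refine Finset.sum_congr rfl fun ℓ _ => ?_
  rw [← Finset.sum_add_distrib]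
  refine Finset.sum_congr rfl fun m _ => ?_
  simp only [Pi.add_apply]
  ring

/-- `B` is additive in the second variable. [folklore] -/
theorem Bf_add_right (u v₁ v₂ : ℕ → ℂ) : Bf N u (v₁ + v₂) = Bf N u v₁ + Bf N u v₂ := by
  unfold Bf
  rw [← Finset.sum_add_distrib]
  refine Finset.sum_congr rfl fun ℓ _ => ?_
  rw [← Finset.sum_add_distrib]
  refine Finset.sum_congr rfl fun m _ => ?_
  simp only [Pi.add_apply, map_add]
  ring

/-- `y = z + w`. [cite: Radziwill2012, §7] -/
theorem yv_eq_zC_add_wv (a : ℕ → ℂ) : yv N a = zC N + wv N a := by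
  funext ℓ
  simp [wv]

/-- `B(y,y) = B(z,z) + B(z,w) + B(w,z) + B(w,w)`. [cite: Radziwill2012, §7 (7.9)] -/
theorem Bf_yv_yv (a : ℕ → ℂ) :
    Bf N (yv N a) (yv N a) =
      Bf N (zC N) (zC N) + (Bf N (zC N) (wv N a) + Bf N (wv N a) (zC N)) +
        Bf N (wv N a) (wv N a) := by
  rw [yv_eq_zC_add_wv, Bf_add_left, Bf_add_right, Bf_add_right]
  ring

/-! ### `Λ ⋆ μ = −μ·log` and `(Λ·id) ⋆ φ = h` -/

/-- `D 1 = 0`. [folklore] -/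
theorem Dlog_one : Dlog (1 : ArithmeticFunction ℝ) = 0 := by
  ext n
  rw [Dlog_apply, one_apply, ArithmeticFunction.zero_apply]
  split_ifs with h
  · subst h; simp
  · simp

/-- `Λ ⋆ μ = −D μ`, i.e. `∑_{ℓ m = k} μ(ℓ)Λ(m) = −μ(k) log k`. [folklore] -/
theorem moebius_mul_vonMangoldt :
    (μ : ArithmeticFunction ℝ) * Λ = -Dlog (μ : ArithmeticFunction ℝ) := by
  have h1 : Dlog ((μ : ArithmeticFunction ℝ) * ζ) = 0 := by
    rw [coe_moebius_mul_coe_zeta, Dlog_one]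
  rw [Dlog_mul, Dlog_zeta, moebius_mul_log_eq_vonMangoldt] at h1
  -- `Dμ ⋆ ζ = -Λ`, multiply by `μ`
  have h2 : Dlog (μ : ArithmeticFunction ℝ) * ζ = -Λ := by
    rw [← sub_eq_zero, sub_neg_eq_add, h1]
  have h3 : Dlog (μ : ArithmeticFunction ℝ) = -Λ * μ := by
    calc Dlog (μ : ArithmeticFunction ℝ) = Dlog (μ : ArithmeticFunction ℝ) * (ζ * μ) := by
          rw [coe_zeta_mul_coe_moebius, mul_one]
      _ = -Λ * μ := by rw [← mul_assoc, h2]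
  rw [h3, mul_comm]
  ring

/-- `∑_{ℓ m = k} μ(ℓ) Λ(m) = −μ(k) log k`. [folklore] -/
theorem sum_antidiagonal_moebius_mul_vonMangoldt (k : ℕ) :
    ∑ q ∈ k.divisorsAntidiagonal, (μ q.1 : ℝ) * Λ q.2 = -((μ k : ℝ) * Real.log k) := by
  have h := congrArg (fun f : ArithmeticFunction ℝ => f k) moebius_mul_vonMangoldt
  simp only [ArithmeticFunction.mul_apply, ArithmeticFunction.neg_apply, Dlog_apply,
    intCoe_apply] at h
  exact h

/-- Pointwise multiplication by a completely multiplicative weight distributes over `⋆`.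
[folklore] -/
theorem pmul_mul_pmul (f g c : ArithmeticFunction ℝ) (hc : ∀ m n : ℕ, c (m * n) = c m * c n) :
    f.pmul c * g.pmul c = (f * g).pmul c := by
  ext n
  simp only [ArithmeticFunction.mul_apply, pmul_apply, Finset.sum_mul]
  refine Finset.sum_congr rfl fun q hq => ?_
  have hq' := (Nat.mem_divisorsAntidiagonal.1 hq).1
  rw [← hq', hc]
  ring

/-- `(Λ·id) ⋆ φ = h`: `∑_{ℓ m = k} φ(ℓ) Λ(m) m = h(k)` (`= φ(k) log k + (φ ⋆ Λ)(k)`).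
[cite: Radziwill2012, proof of Lemma 12] -/
theorem vonMangoldt_pmul_id_mul_phiR : (vonMangoldt.pmul idR) * phiR = hAF := by
  have hφ : phiR = idR * (μ : ArithmeticFunction ℝ) := by
    calc phiR = phiR * (ζ * μ) := by rw [coe_zeta_mul_coe_moebius, mul_one]
      _ = idR * μ := by rw [← mul_assoc, phiR_mul_zeta]
  have hid : idR = (ζ : ArithmeticFunction ℝ).pmul idR := by
    ext n
    rw [pmul_apply, natCoe_apply, zeta_apply]
    split_ifs with h
    · subst h; simp
    · simp
  have hc : ∀ m n : ℕ, idR (m * n) = idR m * idR n := by intro m n; simp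
  calc vonMangoldt.pmul idR * phiR = (vonMangoldt.pmul idR * (ζ : ArithmeticFunction ℝ).pmul idR) * μ := by
        rw [hφ, ← mul_assoc, ← hid]
    _ = (Λ * ζ).pmul idR * μ := by rw [pmul_mul_pmul _ _ _ hc]
    _ = Dlog idR * μ := by
        rw [vonMangoldt_mul_zeta]
        congr 1
        ext n
        rw [pmul_apply, Dlog_apply, log_apply, idR_apply, mul_comm]
    _ = hAF := by rw [← hAF_mul_zeta, mul_assoc, coe_zeta_mul_coe_moebius, mul_one]

/-- `∑_{ℓ m = k} φ(ℓ) Λ(m) m = h(k)`. [cite: Radziwill2012, proof of Lemma 12] -/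
theorem sum_antidiagonal_totient_mul_vonMangoldt_mul (k : ℕ) :
    ∑ q ∈ k.divisorsAntidiagonal, (q.1.totient : ℝ) * (Λ q.2 * q.2) = hAF k := by
  have h := congrArg (fun f : ArithmeticFunction ℝ => f k) vonMangoldt_pmul_id_mul_phiR
  simp only [ArithmeticFunction.mul_apply, pmul_apply, idR_apply, phiR_apply] at h
  rw [← h, Nat.sum_divisorsAntidiagonal (fun i j => (i.totient : ℝ) * (Λ j * j)),
    Nat.sum_divisorsAntidiagonal' (fun i j => Λ i * (i : ℝ) * (j.totient : ℝ))]
  refine Finset.sum_congr rfl fun i _ => ?_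
  ring

/-! ### `B(z,z)`, `B(w,z)`, `B(z,w)` -/

/-- **`S₃` in closed form**: `B(z,z) = −(1/G²) ∑_{k ≤ N} μ(k)² log k/φ(k)`.
[cite: Radziwill2012, Lemma 14] -/
theorem Bf_zC_zC (hN : 1 ≤ N) :
    Bf N (zC N) (zC N) =
      ((-(1 / Gs N ^ 2) * ∑ k ∈ Icc 1 N, ((μ k : ℝ)) ^ 2 * Real.log k / (k.totient : ℝ) : ℝ) : ℂ) := by
  have hG := (Gs_pos hN).ne'
  -- the summand, in `ℝ`
  have hterm : ∀ ℓ ∈ Icc 1 N, ∀ m ∈ Icc 1 (N / ℓ),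
      (((ℓ.totient : ℝ) * Λ m / ((ℓ : ℝ) ^ 2 * m) : ℝ) : ℂ) * (zC N (m * ℓ) * conj (zC N ℓ)) =
        (((1 / Gs N ^ 2) * ((μ ℓ : ℝ) * Λ m * ((μ (m * ℓ) : ℝ) / ((m * ℓ).totient : ℝ))) : ℝ) :
          ℂ) := by
    intro ℓ hℓ m hm
    have hℓ1 : 1 ≤ ℓ := (mem_Icc.1 hℓ).1
    have hm1 : 1 ≤ m := (mem_Icc.1 hm).1
    have hℓ0 : (ℓ : ℂ) ≠ 0 := by exact_mod_cast (show ℓ ≠ 0 by omega)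
    have hm0 : (m : ℂ) ≠ 0 := by exact_mod_cast (show m ≠ 0 by omega)
    have hφℓ : (ℓ.totient : ℂ) ≠ 0 := by exact_mod_cast (Nat.totient_pos.2 hℓ1).ne'
    have hφ : ((m * ℓ).totient : ℂ) ≠ 0 := by
      exact_mod_cast (Nat.totient_pos.2 (Nat.mul_pos (by omega) hℓ1)).ne'
    have hG' : (Gs N : ℂ) ≠ 0 := by exact_mod_cast hG
    rw [zC_apply, zC_apply, Complex.conj_ofReal]
    unfold zv
    push_cast
    field_simp
  unfold Bf
  rw [Finset.sum_congr rfl fun ℓ hℓ => Finset.sum_congr rfl fun m hm => hterm ℓ hℓ m hm]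
  simp only [← Complex.ofReal_sum, ← Finset.mul_sum]
  congr 1
  rw [sum_Icc_sum_Icc_div_eq (fun ℓ m => (μ ℓ : ℝ) * Λ m * ((μ (m * ℓ) : ℝ) / ((m * ℓ).totient : ℝ)))]
  rw [neg_mul, ← mul_neg, ← Finset.sum_neg_distrib]
  congr 1
  refine Finset.sum_congr rfl fun k hk => ?_
  have h1 : ∀ q ∈ k.divisorsAntidiagonal,
      (μ q.1 : ℝ) * Λ q.2 * ((μ (q.2 * q.1) : ℝ) / ((q.2 * q.1).totient : ℝ)) =
        (μ k : ℝ) / (k.totient : ℝ) * ((μ q.1 : ℝ) * Λ q.2) := by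
    intro q hq
    have hq' := (Nat.mem_divisorsAntidiagonal.1 hq).1
    rw [mul_comm q.2 q.1, hq']
    ring
  rw [Finset.sum_congr rfl h1, ← Finset.mul_sum, sum_antidiagonal_moebius_mul_vonMangoldt]
  ring

/-- **First half of `S₂`**: `B(w,z) = −(1/G) ∑_{k ≤ N} w(k) μ(k) log k/k`.
[cite: Radziwill2012, Lemma 13 (7.10)] -/
theorem Bf_wv_zC (a : ℕ → ℂ) (hN : 1 ≤ N) :
    Bf N (wv N a) (zC N) =
      -(1 / Gs N : ℂ) * ∑ k ∈ Icc 1 N, wv N a k * (((μ k : ℝ) * Real.log k / k : ℝ) : ℂ) := by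
  have hG := (Gs_pos hN).ne'
  have hterm : ∀ ℓ ∈ Icc 1 N, ∀ m ∈ Icc 1 (N / ℓ),
      (((ℓ.totient : ℝ) * Λ m / ((ℓ : ℝ) ^ 2 * m) : ℝ) : ℂ) * (wv N a (m * ℓ) * conj (zC N ℓ)) =
        (1 / Gs N : ℂ) * ((((μ ℓ : ℝ) * Λ m : ℝ) : ℂ) * (wv N a (ℓ * m) / ((ℓ : ℂ) * m))) := by
    intro ℓ hℓ m hm
    have hℓ1 : 1 ≤ ℓ := (mem_Icc.1 hℓ).1
    have hm1 : 1 ≤ m := (mem_Icc.1 hm).1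
    have hℓ0 : (ℓ : ℂ) ≠ 0 := by exact_mod_cast (show ℓ ≠ 0 by omega)
    have hm0 : (m : ℂ) ≠ 0 := by exact_mod_cast (show m ≠ 0 by omega)
    have hφℓ : (ℓ.totient : ℂ) ≠ 0 := by
      exact_mod_cast (Nat.totient_pos.2 hℓ1).ne'
    have hG' : (Gs N : ℂ) ≠ 0 := by exact_mod_cast hG
    rw [zC_apply, Complex.conj_ofReal, mul_comm m ℓ]
    unfold zv
    push_cast
    field_simp
  unfold Bf
  rw [Finset.sum_congr rfl fun ℓ hℓ => Finset.sum_congr rfl fun m hm => hterm ℓ hℓ m hm]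
  simp only [← Finset.mul_sum]
  rw [sum_Icc_sum_Icc_div_eq (fun ℓ m => ((((μ ℓ : ℝ) * Λ m : ℝ) : ℂ) * (wv N a (ℓ * m) / ((ℓ : ℂ) * m))))]
  rw [neg_mul, ← mul_neg, ← Finset.sum_neg_distrib]
  congr 1
  refine Finset.sum_congr rfl fun k hk => ?_
  have h1 : ∀ q ∈ k.divisorsAntidiagonal,
      ((((μ q.1 : ℝ) * Λ q.2 : ℝ) : ℂ) * (wv N a (q.1 * q.2) / ((q.1 : ℂ) * q.2))) =
        wv N a k / k * (((μ q.1 : ℝ) * Λ q.2 : ℝ) : ℂ) := by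
    intro q hq
    have hq' := (Nat.mem_divisorsAntidiagonal.1 hq).1
    rw [← Nat.cast_mul, hq']
    ring
  rw [Finset.sum_congr rfl h1, ← Finset.mul_sum, ← Complex.ofReal_sum,
    sum_antidiagonal_moebius_mul_vonMangoldt]
  push_cast
  ring

/-- `ρ(ℓ) = φ(ℓ) ∑_{m ≤ N/ℓ} Λ(m) μ(mℓ)/φ(mℓ)` (for squarefree `ℓ` this is
`−μ(ℓ) ∑_{p ≤ N/ℓ, p ∤ ℓ} log p/(p − 1)`, and `0` otherwise). [cite: Radziwill2012, Lemma 13] -/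
def rho (N : ℕ) (ℓ : ℕ) : ℝ :=
  (ℓ.totient : ℝ) * ∑ m ∈ Icc 1 (N / ℓ), Λ m * ((μ (m * ℓ) : ℝ) / ((m * ℓ).totient : ℝ))

/-- **Second half of `S₂`**: `B(z,w) = (1/G) ∑_{ℓ ≤ N} w̄(ℓ) ρ(ℓ)/ℓ`.
[cite: Radziwill2012, Lemma 13] -/
theorem Bf_zC_wv (a : ℕ → ℂ) (hN : 1 ≤ N) :
    Bf N (zC N) (wv N a) =
      (1 / Gs N : ℂ) * ∑ ℓ ∈ Icc 1 N, conj (wv N a ℓ) * ((rho N ℓ / ℓ : ℝ) : ℂ) := by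
  have hG := (Gs_pos hN).ne'
  unfold Bf
  rw [Finset.mul_sum]
  refine Finset.sum_congr rfl fun ℓ hℓ => ?_
  have hℓ1 : 1 ≤ ℓ := (mem_Icc.1 hℓ).1
  have hℓ0 : (ℓ : ℂ) ≠ 0 := by exact_mod_cast (show ℓ ≠ 0 by omega)
  have hG' : (Gs N : ℂ) ≠ 0 := by exact_mod_cast hG
  unfold rho
  push_cast
  rw [Finset.mul_sum, Finset.sum_div, Finset.mul_sum, Finset.mul_sum]
  refine Finset.sum_congr rfl fun m hm => ?_
  have hm1 : 1 ≤ m := (mem_Icc.1 hm).1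
  have hm0 : (m : ℂ) ≠ 0 := by exact_mod_cast (show m ≠ 0 by omega)
  have hφ : (((m * ℓ).totient : ℝ) : ℂ) ≠ 0 := by
    exact_mod_cast (Nat.totient_pos.2 (Nat.mul_pos (by omega) hℓ1)).ne'
  rw [zC_apply]
  unfold zv
  push_cast
  field_simp

/-- **The cross terms `S₂`, real part**:
`Re(B(z,w) + B(w,z)) = (1/G) ∑_ℓ Re w(ℓ)/ℓ · (ρ(ℓ) − μ(ℓ) log ℓ)`.
[cite: Radziwill2012, Lemma 13] -/
theorem re_Bf_cross (a : ℕ → ℂ) (hN : 1 ≤ N) :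
    (Bf N (zC N) (wv N a) + Bf N (wv N a) (zC N)).re =
      1 / Gs N * ∑ ℓ ∈ Icc 1 N, (wv N a ℓ).re / ℓ * (rho N ℓ - (μ ℓ : ℝ) * Real.log ℓ) := by
  rw [Bf_zC_wv a hN, Bf_wv_zC a hN, Complex.add_re]
  have h1 : ((1 / Gs N : ℂ) * ∑ ℓ ∈ Icc 1 N, conj (wv N a ℓ) * ((rho N ℓ / ℓ : ℝ) : ℂ)).re =
      1 / Gs N * ∑ ℓ ∈ Icc 1 N, (wv N a ℓ).re * (rho N ℓ / ℓ) := by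
    rw [show (1 / Gs N : ℂ) = ((1 / Gs N : ℝ) : ℂ) by push_cast; ring, Complex.re_ofReal_mul,
      Complex.re_sum]
    congr 1
    refine Finset.sum_congr rfl fun ℓ _ => ?_
    rw [Complex.re_mul_ofReal, Complex.conj_re]
  have h2 : (-(1 / Gs N : ℂ) * ∑ k ∈ Icc 1 N, wv N a k * (((μ k : ℝ) * Real.log k / k : ℝ) : ℂ)).re =
      -(1 / Gs N) * ∑ k ∈ Icc 1 N, (wv N a k).re * ((μ k : ℝ) * Real.log k / k) := by
    rw [show (-(1 / Gs N : ℂ)) = ((-(1 / Gs N) : ℝ) : ℂ) by push_cast; ring, Complex.re_ofReal_mul,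
      Complex.re_sum]
    congr 1
    refine Finset.sum_congr rfl fun ℓ _ => ?_
    rw [Complex.re_mul_ofReal]
  rw [h1, h2, neg_mul, ← sub_eq_add_neg, ← mul_sub, ← Finset.sum_sub_distrib]
  congr 1
  refine Finset.sum_congr rfl fun ℓ _ => ?_
  ring

/-- The constraint `∑_{ℓ ≤ N} μ(ℓ) w(ℓ)/ℓ = 0` (real part), from Möbius inversion and
`∑ μ(ℓ) z(ℓ)/ℓ = (1/G) ∑ μ(ℓ)²/φ(ℓ) = 1`. [cite: Radziwill2012, Lemma 13 ("the sum simplifies")] -/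
theorem sum_moebius_mul_re_wv_div (a : ℕ → ℂ) (ha : a 1 = 1) (hN : 1 ≤ N) :
    ∑ ℓ ∈ Icc 1 N, (μ ℓ : ℝ) * (wv N a ℓ).re / ℓ = 0 := by
  have hG := (Gs_pos hN).ne'
  have hy : ∑ ℓ ∈ Icc 1 N, (μ ℓ : ℝ) * (yv N a ℓ).re / ℓ = 1 := by
    have h := congrArg Complex.re (sum_moebius_mul_yv_div a hN)
    rw [ha, Complex.one_re, Complex.re_sum] at h
    rw [← h]
    refine Finset.sum_congr rfl fun ℓ _ => ?_
    have : (μ ℓ : ℂ) * yv N a ℓ / ℓ = (((μ ℓ : ℝ) / ℓ : ℝ) : ℂ) * yv N a ℓ := by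
      push_cast; ring
    rw [this, Complex.re_ofReal_mul]
    ring
  have hz : ∑ ℓ ∈ Icc 1 N, (μ ℓ : ℝ) * zv N ℓ / ℓ = 1 := by
    have h1 : ∀ ℓ ∈ Icc 1 N, (μ ℓ : ℝ) * zv N ℓ / ℓ = (1 / Gs N) * (((μ ℓ : ℝ)) ^ 2 / (ℓ.totient : ℝ)) := by
      intro ℓ hℓ
      have hℓ1 : 1 ≤ ℓ := (mem_Icc.1 hℓ).1
      have hℓ0 : (ℓ : ℝ) ≠ 0 := by exact_mod_cast (show ℓ ≠ 0 by omega)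
      have hφ : (ℓ.totient : ℝ) ≠ 0 := by exact_mod_cast (Nat.totient_pos.2 hℓ1).ne'
      unfold zv
      field_simp
    rw [Finset.sum_congr rfl h1, ← Finset.mul_sum]
    unfold Gs at hG ⊢
    field_simp
  have : ∀ ℓ ∈ Icc 1 N, (μ ℓ : ℝ) * (wv N a ℓ).re / ℓ =
      (μ ℓ : ℝ) * (yv N a ℓ).re / ℓ - (μ ℓ : ℝ) * zv N ℓ / ℓ := by
    intro ℓ _
    unfold wv
    rw [Complex.sub_re, Complex.ofReal_re]
    ring
  rw [Finset.sum_congr rfl this, Finset.sum_sub_distrib, hy, hz, sub_self]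

/-- **Bound for the cross terms** (Lemma 13): if `|ρ(ℓ) + μ(ℓ)(L − log ℓ)| ≤ K μ(ℓ)²` for all
`ℓ ≤ N` (in the application `L = log N`, `K = O(log log N)`: `ρ(ℓ) = −μ(ℓ) ∑_{p ≤ N/ℓ, p∤ℓ} log p/(p−1)`),
then `|Re(B(z,w) + B(w,z))| ≤ (K/G) ∑_ℓ μ(ℓ)² |w(ℓ)|/ℓ`, using the constraint `∑ μ(ℓ) Re w(ℓ)/ℓ = 0`
to insert the free constant `L`. [cite: Radziwill2012, Lemma 13] -/
theorem abs_re_Bf_cross_le (a : ℕ → ℂ) (ha : a 1 = 1) (hN : 1 ≤ N) {K L : ℝ}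
    (hρ : ∀ ℓ ∈ Icc 1 N, |rho N ℓ + (μ ℓ : ℝ) * (L - Real.log ℓ)| ≤ K * ((μ ℓ : ℝ)) ^ 2) :
    |(Bf N (zC N) (wv N a) + Bf N (wv N a) (zC N)).re| ≤
      K / Gs N * ∑ ℓ ∈ Icc 1 N, ((μ ℓ : ℝ)) ^ 2 * ‖wv N a ℓ‖ / ℓ := by
  have hG := Gs_pos hN
  rw [re_Bf_cross a hN]
  have hins : ∑ ℓ ∈ Icc 1 N, (wv N a ℓ).re / ℓ * (rho N ℓ - (μ ℓ : ℝ) * Real.log ℓ) =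
      ∑ ℓ ∈ Icc 1 N, (wv N a ℓ).re / ℓ * (rho N ℓ + (μ ℓ : ℝ) * (L - Real.log ℓ)) := by
    have h0 := sum_moebius_mul_re_wv_div a ha hN
    have : ∑ ℓ ∈ Icc 1 N, (wv N a ℓ).re / ℓ * (rho N ℓ + (μ ℓ : ℝ) * (L - Real.log ℓ)) =
        ∑ ℓ ∈ Icc 1 N, (wv N a ℓ).re / ℓ * (rho N ℓ - (μ ℓ : ℝ) * Real.log ℓ) +
          L * ∑ ℓ ∈ Icc 1 N, (μ ℓ : ℝ) * (wv N a ℓ).re / ℓ := by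
      rw [Finset.mul_sum, ← Finset.sum_add_distrib]
      refine Finset.sum_congr rfl fun ℓ _ => ?_
      ring
    rw [this, h0, mul_zero, add_zero]
  rw [hins, abs_mul, abs_of_pos (by positivity), div_eq_mul_one_div K, mul_comm K, mul_assoc,
    Finset.mul_sum]
  refine mul_le_mul_of_nonneg_left ?_ (by positivity)
  refine (Finset.abs_sum_le_sum_abs _ _).trans (Finset.sum_le_sum fun ℓ hℓ => ?_)
  have hℓ1 : 1 ≤ ℓ := (mem_Icc.1 hℓ).1
  have hℓpos : (0 : ℝ) < ℓ := by exact_mod_cast hℓ1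
  rw [abs_mul, abs_div, abs_of_pos hℓpos]
  have hre : |(wv N a ℓ).re| ≤ ‖wv N a ℓ‖ := Complex.abs_re_le_norm _
  have hK := hρ ℓ hℓ
  calc |(wv N a ℓ).re| / ℓ * |rho N ℓ + (μ ℓ : ℝ) * (L - Real.log ℓ)|
      ≤ ‖wv N a ℓ‖ / ℓ * (K * ((μ ℓ : ℝ)) ^ 2) := by
        apply mul_le_mul (div_le_div_of_nonneg_right hre hℓpos.le) hK (abs_nonneg _)
          (by positivity)
    _ = K * (((μ ℓ : ℝ)) ^ 2 * ‖wv N a ℓ‖ / ℓ) := by ring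

/-! ### `S₁`: the bound for `B(w, w)` by `2|ab| ≤ |a|² + |b|²` -/

/-- **Lemma 12, algebraic core**:
`2|B(w,w)| ≤ ∑_ℓ φ(ℓ)/ℓ² |w(ℓ)|² ∑_{m ≤ N/ℓ} Λ(m)/m + ∑_k h(k)/k² |w(k)|²`, where
`h(k) = ∑_{ℓm = k} φ(ℓ)Λ(m) m = φ(k) log k + (φ ⋆ Λ)(k)`. [cite: Radziwill2012, Lemma 12] -/
theorem two_mul_norm_Bf_wv_wv_le (a : ℕ → ℂ) :
    2 * ‖Bf N (wv N a) (wv N a)‖ ≤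
      ∑ ℓ ∈ Icc 1 N, (ℓ.totient : ℝ) / (ℓ : ℝ) ^ 2 * ‖wv N a ℓ‖ ^ 2 *
          ∑ m ∈ Icc 1 (N / ℓ), Λ m / m +
        ∑ k ∈ Icc 1 N, hAF k / (k : ℝ) ^ 2 * ‖wv N a k‖ ^ 2 := by
  set w := wv N a with hw
  -- termwise bound
  have hterm : ∀ ℓ ∈ Icc 1 N, ∀ m ∈ Icc 1 (N / ℓ),
      2 * ‖(((ℓ.totient : ℝ) * Λ m / ((ℓ : ℝ) ^ 2 * m) : ℝ) : ℂ) * (w (m * ℓ) * conj (w ℓ))‖ ≤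
        (ℓ.totient : ℝ) / (ℓ : ℝ) ^ 2 * ‖w ℓ‖ ^ 2 * (Λ m / m) +
          (ℓ.totient : ℝ) * (Λ m * m) * (‖w (m * ℓ)‖ ^ 2 / ((m * ℓ : ℕ) : ℝ) ^ 2) := by
    intro ℓ hℓ m hm
    have hℓ1 : 1 ≤ ℓ := (mem_Icc.1 hℓ).1
    have hm1 : 1 ≤ m := (mem_Icc.1 hm).1
    have hℓ0 : (0 : ℝ) < ℓ := by exact_mod_cast hℓ1
    have hm0 : (0 : ℝ) < m := by exact_mod_cast hm1
    have hc : 0 ≤ (ℓ.totient : ℝ) * Λ m / ((ℓ : ℝ) ^ 2 * m) := by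
      have := vonMangoldt_nonneg (n := m); positivity
    rw [norm_mul, Complex.norm_real, Real.norm_eq_abs, abs_of_nonneg hc, norm_mul,
      Complex.norm_conj]
    have h2 : 2 * (‖w (m * ℓ)‖ * ‖w ℓ‖) ≤ ‖w ℓ‖ ^ 2 + ‖w (m * ℓ)‖ ^ 2 := by
      nlinarith [sq_nonneg (‖w (m * ℓ)‖ - ‖w ℓ‖)]
    have key : (ℓ.totient : ℝ) / (ℓ : ℝ) ^ 2 * ‖w ℓ‖ ^ 2 * (Λ m / m) +
        (ℓ.totient : ℝ) * (Λ m * m) * (‖w (m * ℓ)‖ ^ 2 / ((m * ℓ : ℕ) : ℝ) ^ 2) =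
        (ℓ.totient : ℝ) * Λ m / ((ℓ : ℝ) ^ 2 * m) * (‖w ℓ‖ ^ 2 + ‖w (m * ℓ)‖ ^ 2) := by
      push_cast
      field_simp
    rw [key]
    calc 2 * ((ℓ.totient : ℝ) * Λ m / ((ℓ : ℝ) ^ 2 * m) * (‖w (m * ℓ)‖ * ‖w ℓ‖))
        = (ℓ.totient : ℝ) * Λ m / ((ℓ : ℝ) ^ 2 * m) * (2 * (‖w (m * ℓ)‖ * ‖w ℓ‖)) := by ring
      _ ≤ (ℓ.totient : ℝ) * Λ m / ((ℓ : ℝ) ^ 2 * m) * (‖w ℓ‖ ^ 2 + ‖w (m * ℓ)‖ ^ 2) :=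
          mul_le_mul_of_nonneg_left h2 hc
  -- sum the termwise bounds
  have hsum : 2 * ‖Bf N w w‖ ≤ ∑ ℓ ∈ Icc 1 N, ∑ m ∈ Icc 1 (N / ℓ),
      ((ℓ.totient : ℝ) / (ℓ : ℝ) ^ 2 * ‖w ℓ‖ ^ 2 * (Λ m / m) +
        (ℓ.totient : ℝ) * (Λ m * m) * (‖w (m * ℓ)‖ ^ 2 / ((m * ℓ : ℕ) : ℝ) ^ 2)) := by
    unfold Bf
    calc 2 * ‖∑ ℓ ∈ Icc 1 N, ∑ m ∈ Icc 1 (N / ℓ),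
          (((ℓ.totient : ℝ) * Λ m / ((ℓ : ℝ) ^ 2 * m) : ℝ) : ℂ) * (w (m * ℓ) * conj (w ℓ))‖
        ≤ 2 * ∑ ℓ ∈ Icc 1 N, ∑ m ∈ Icc 1 (N / ℓ),
          ‖(((ℓ.totient : ℝ) * Λ m / ((ℓ : ℝ) ^ 2 * m) : ℝ) : ℂ) * (w (m * ℓ) * conj (w ℓ))‖ := by
          gcongr
          exact (norm_sum_le _ _).trans (Finset.sum_le_sum fun ℓ _ => norm_sum_le _ _)
      _ = ∑ ℓ ∈ Icc 1 N, ∑ m ∈ Icc 1 (N / ℓ),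
          2 * ‖(((ℓ.totient : ℝ) * Λ m / ((ℓ : ℝ) ^ 2 * m) : ℝ) : ℂ) * (w (m * ℓ) * conj (w ℓ))‖ := by
          rw [Finset.mul_sum]
          refine Finset.sum_congr rfl fun ℓ _ => ?_
          rw [Finset.mul_sum]
      _ ≤ _ := Finset.sum_le_sum fun ℓ hℓ => Finset.sum_le_sum fun m hm => hterm ℓ hℓ m hm
  refine hsum.trans (le_of_eq ?_)
  simp only [Finset.sum_add_distrib]
  congr 1
  · refine Finset.sum_congr rfl fun ℓ _ => ?_
    rw [Finset.mul_sum]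
  · rw [sum_Icc_sum_Icc_div_eq (fun ℓ m =>
      (ℓ.totient : ℝ) * (Λ m * m) * (‖w (m * ℓ)‖ ^ 2 / ((m * ℓ : ℕ) : ℝ) ^ 2))]
    refine Finset.sum_congr rfl fun k hk => ?_
    have h1 : ∀ q ∈ k.divisorsAntidiagonal,
        (q.1.totient : ℝ) * (Λ q.2 * q.2) * (‖w (q.2 * q.1)‖ ^ 2 / ((q.2 * q.1 : ℕ) : ℝ) ^ 2) =
          ‖w k‖ ^ 2 / (k : ℝ) ^ 2 * ((q.1.totient : ℝ) * (Λ q.2 * q.2)) := by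
      intro q hq
      have hq' := (Nat.mem_divisorsAntidiagonal.1 hq).1
      rw [mul_comm q.2 q.1, hq']
      ring
    rw [Finset.sum_congr rfl h1, ← Finset.mul_sum, sum_antidiagonal_totient_mul_vonMangoldt_mul]
    ring

end PropB

end Literature.Barriers.RiemannHypothesis
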